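import Summits.QuantumFields.YangMills.Theorems.ColdStartUniversalityLatticeLangevinBatchMeans
import HarnessLib

/-!
# Route `ColdStartUniversality` (fixed-cut-off SZZ dynamics): consistency of the batch-means estimator along EVERY strong solution

Helper file (seat `ym-line-csu-p1`, g34; `--supports stmt-QuantumFields-24809`).  The L²-consistency bound of the companion file
(`integral_sq_batchMeans_sub_le_of_prog`, progressively measurable solutions) transferred to EVERY strong solution of the SU(2) SZZ dynamics from a
deterministic start on ANY probability space by pathwise uniqueness against the regular flow:
* ★★★ `integral_sq_batchMeans_sub_le` — `E[((Jb)⁻¹ Σ_(j<J) (∫_(jb,(j+1)b] Ĝ(U_r)dr)² − σ²)²] ≤ (8b|σ²| + 8K + 2σ⁴)/J + K(2|σ²| + K/b)/b`.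
THEOREMS ONLY, no definition, no sorry; [folklore].  HONEST FRAMING: fixed cut-off; `K` depends on `L, β'`; `UniformColdStartMixing` (24809) is NOT
restated; no crux, rung or summit statement is proved; the Yang–Mills mass gap is NOT proved.
-/

set_option autoImplicit false

noncomputable section

namespace Summit.QuantumFields.YangMills.Theorems.ColdStartUniversality

open MeasureTheory ProbabilityTheory Filter Topology Set
open scoped NNReal ENNReal BigOperators
open Literature Literature.Probability.Process Literature.MathematicalPhysics.QuantumFieldTheory
open Literature.MathematicalPhysics.QuantumLattice (fundamentalRep fundamentalLatticeRep continuous_fundamentalRep)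

variable {L : ℕ} [NeZero L]

/-- ★★★ **L²-consistency of the batch-means estimator along EVERY strong solution** (every coupling; `K` depends on `L, β'`): as
`integral_sq_batchMeans_sub_le_of_prog`, without the progressive-measurability hypothesis. [folklore] -/
theorem integral_sq_batchMeans_sub_le (L : ℕ) [NeZero L] (β' : ℝ) :
    ∃ K : ℝ, 0 ≤ K ∧
      ∀ (κ : ℝ≥0 → Kernel (GaugeConfig 3 L (Matrix.specialUnitaryGroup (Fin 2) ℂ))
          (GaugeConfig 3 L (Matrix.specialUnitaryGroup (Fin 2) ℂ))) [∀ t, IsMarkovKernel (κ t)],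
        (∀ (t : ℝ≥0) (x : GaugeConfig 3 L (Matrix.specialUnitaryGroup (Fin 2) ℂ))
          (Ω : Type) [MeasurableSpace Ω] (P : Measure Ω) [IsProbabilityMeasure P]
          (W : ℝ≥0 → Ω → (Edge 3 L × NoiseIdx 2 → ℝ)) (hW : IsFlatBrownian W P)
          (U : ℝ≥0 → Ω → GaugeConfig 3 L (Matrix.specialUnitaryGroup (Fin 2) ℂ)),
          (∀ ω, U 0 ω = x) →
          (latticeLangevinDynamics (fundamentalLatticeRep 2) β').IsSolution (fundamentalRep (Fin 2))
            hW.natFiltration P W U →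
          κ t x = P.map (U t)) →
        ∀ (x : GaugeConfig 3 L (Matrix.specialUnitaryGroup (Fin 2) ℂ))
          (Ω : Type) [MeasurableSpace Ω] (P : Measure Ω) [IsProbabilityMeasure P]
          (W : ℝ≥0 → Ω → (Edge 3 L × NoiseIdx 2 → ℝ)) (hW : IsFlatBrownian W P)
          (U : ℝ≥0 → Ω → GaugeConfig 3 L (Matrix.specialUnitaryGroup (Fin 2) ℂ)),
          (∀ ω, U 0 ω = x) →
          (latticeLangevinDynamics (fundamentalLatticeRep 2) β').IsSolution (fundamentalRep (Fin 2)) hW.natFiltration P W U →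
        ∀ (G : GaugeConfig 3 L (Matrix.specialUnitaryGroup (Fin 2) ℂ) → ℝ), Continuous G → (∀ z, |G z| ≤ 1) →
        ∀ (b : ℝ), 0 < b → ∀ (J : ℕ), 1 ≤ J →
          ∫ ω, (((J : ℝ) * b)⁻¹ * (∑ j ∈ Finset.range J,
              (∫ r in Ioc ((j : ℝ) * b) (((j : ℝ) + 1) * b), (G (U r.toNNReal ω) - ∫ z, G z ∂(wilsonMeasure (d := 3) (L := L) (fundamentalRep (Fin 2)) β'))) ^ 2) -
              2 * ∫ t in Ioi (0 : ℝ), (∫ y, (G y - ∫ z, G z ∂(wilsonMeasure (d := 3) (L := L) (fundamentalRep (Fin 2)) β')) *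
                (∫ z, (G z - ∫ z', G z' ∂(wilsonMeasure (d := 3) (L := L) (fundamentalRep (Fin 2)) β')) ∂(κ t.toNNReal y))
                ∂(wilsonMeasure (d := 3) (L := L) (fundamentalRep (Fin 2)) β'))) ^ 2 ∂P ≤
            (8 * b * |2 * ∫ t in Ioi (0 : ℝ), (∫ y, (G y - ∫ z, G z ∂(wilsonMeasure (d := 3) (L := L) (fundamentalRep (Fin 2)) β')) *
                (∫ z, (G z - ∫ z', G z' ∂(wilsonMeasure (d := 3) (L := L) (fundamentalRep (Fin 2)) β')) ∂(κ t.toNNReal y))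
                ∂(wilsonMeasure (d := 3) (L := L) (fundamentalRep (Fin 2)) β'))| + 8 * K +
              2 * (2 * ∫ t in Ioi (0 : ℝ), (∫ y, (G y - ∫ z, G z ∂(wilsonMeasure (d := 3) (L := L) (fundamentalRep (Fin 2)) β')) *
                (∫ z, (G z - ∫ z', G z' ∂(wilsonMeasure (d := 3) (L := L) (fundamentalRep (Fin 2)) β')) ∂(κ t.toNNReal y))
                ∂(wilsonMeasure (d := 3) (L := L) (fundamentalRep (Fin 2)) β'))) ^ 2) / J +
            K * (2 * |2 * ∫ t in Ioi (0 : ℝ), (∫ y, (G y - ∫ z, G z ∂(wilsonMeasure (d := 3) (L := L) (fundamentalRep (Fin 2)) β')) *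
                (∫ z, (G z - ∫ z', G z' ∂(wilsonMeasure (d := 3) (L := L) (fundamentalRep (Fin 2)) β')) ∂(κ t.toNNReal y))
                ∂(wilsonMeasure (d := 3) (L := L) (fundamentalRep (Fin 2)) β'))| + K / b) / b := by
  classical
  obtain ⟨K, hK, h⟩ := integral_sq_batchMeans_sub_le_of_prog L β'
  refine ⟨K, hK, fun κ _ hreal x Ω _ P _ W hW U hU0 hU G hG hG1 b hb J hJ => ?_⟩
  obtain ⟨V, -, hV, hVprog, -, -, -⟩ := exists_regularFlow L β' hW
  have hprog : ∀ i : ℝ≥0, Measurable[@Prod.instMeasurableSpace (Set.Iic i) Ω inferInstance (hW.natFiltration i)]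
      (fun q : Set.Iic i × Ω => V x q.1 q.2) := fun i =>
    (hVprog i).comp (measurable_fst.prodMk (measurable_const.prodMk measurable_snd))
  have hmain := h κ hreal x Ω P W hW (V x) (hV x).1 (hV x).2 hprog G hG hG1 b hb J hJ
  have hae := latticeLangevin_pathwise_unique hW β' x hU0 (hV x).1 hU (hV x).2
  refine le_of_eq_of_le (integral_congr_ae ?_) hmain
  filter_upwards [hae] with ω hω
  have hfun : (fun r : ℝ => G (U r.toNNReal ω) - ∫ z, G z ∂(wilsonMeasure (d := 3) (L := L) (fundamentalRep (Fin 2)) β')) =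
      fun r : ℝ => G (V x r.toNNReal ω) - ∫ z, G z ∂(wilsonMeasure (d := 3) (L := L) (fundamentalRep (Fin 2)) β') := funext fun r => by rw [hω]
  simp only [hfun]

end Summit.QuantumFields.YangMills.Theorems.ColdStartUniversality

end
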